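import Summits.CriticalPhenomena.SAWScalingLimit.Theorems.SAWRenewalTightnessTubeLowerBoundSteeredChainHelpers

/-!
# Crux `SAWRenewalTightness.TubeLowerBound` (stmt-CriticalPhenomena-4730), line `lieb-simon-star`:
stub `steeredChain` — one-sided sign steering of a chain of corner crossings

`stub_steeredChain : CornerCrossingFloor → OneSidedReach` (both statements from
`SAWRenewalTightnessTubeLowerBoundDefs`).  From the corner-crossing floor for the tall boxes
`[0, a] × [0, K a]` (constants `K`, `C ≥ 0`, `c > 0`; a cut-off `N` per width), build for every `X ≥ 1` a
sub-family of the flat-box family of `OneSidedReach` (`0 ≤ x ≤ X`, `0 ≤ y`, `5 y ≤ X`, last vertex on `x = X`)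
of mass `≥ (x_c min(c,1))^{2k} X^{−kC}`, `k = 10 K + 2`.  The box families "`n`-step self-avoiding walks from
`0` with `0 ≤ x ≤ w`, `lo ≤ y ≤ hi`, ending on the column `x = w`" and their partial `x_c`-masses
`Σ_{n ≤ N} Σ x_c^n` are written out (they are the local notations `boxAt` / `bmass` of the helpers file
`SAWRenewalTightnessTubeLowerBoundSteeredChainHelpers`, whose lemmas are used):

* `piece_exists` — ONE STEERED PIECE: at current height `y₀ ∈ [0, 2KA]` a piece of width `w ≤ A` is entered
  at its SW corner (window `[0, Kw]`) if `y₀ < Kw` and at its NW corner (the mirror family `y ↦ −y`, window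
  `[−Kw, 0]`, same mass by `bmass_mirror`) otherwise; the new height stays in `[0, 2KA]`;
* `chain_mass` — THE CHAIN (induction on the list of widths): pieces in consecutive disjoint column ranges
  joined by single east edges (`glue_mass` of the helpers file: concatenation is injective and masses
  multiply), total width `Σ (wᵢ + 1) − 1`, mass `≥ (x_c β)^{|ws|}`;
* `stub_steeredChain` — FIT: for `X + 1 ≥ 2k` write `X + 1 = k q + r` (`0 ≤ r < k`, `q ≥ 2`) and use `r`
  pieces of width `q` and `k − r` of width `q − 1` (so the chain ends on `x = X`), heights in
  `[0, 2Kq] ⊆ [0, X/5]`; for `X + 1 < 2k` the straight walk.  Only `0 < x_c ≤ 1` is used.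
-/

noncomputable section

namespace Summit.CriticalPhenomena.SAWScalingLimit.Theorems.TubeLowerBound.LiebSimonStar

open scoped BigOperators Classical
open Literature.Probability.LatticeModels
open Literature.Probability.RandomPlanarGeometry Literature.Probability.RandomPlanarGeometry.SAW

namespace SteeredChain

/-! ### Steering a chain of pieces -/

/-- **One steered piece.** At current height `y₀ ∈ [0, 2KA]`, a piece of width `w ≤ A` with floor `β` for its
up-family (window `[0, Kw]`) is entered at its SW corner (window `[0, Kw]`) if `y₀ < Kw` and at its NW corner
(the mirror family, window `[-Kw, 0]`, same mass) otherwise; either way the window `[lo, hi]` fits into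
`[-y₀, 2KA - y₀]`, every exit height keeps the absolute height in `[0, 2KA]`, and the piece has mass `≥ β`. -/
theorem piece_exists (K A Ns w : ℕ) (β : ℝ) (hwA : w ≤ A)
    (hfl : β ≤ ∑ n ∈ Finset.range (Ns + 1), ∑ _ω ∈ (Zd.saws 2 n).filter (fun ω =>
      (∀ i ≤ n, 0 ≤ ω i 0 ∧ ω i 0 ≤ (w : ℤ) ∧ 0 ≤ ω i 1 ∧ ω i 1 ≤ (K : ℤ) * w) ∧ ω n 0 = (w : ℤ)),
      criticalFugacity ^ n)
    (y₀ : ℤ) (hy0 : 0 ≤ y₀) (hyH : y₀ ≤ 2 * (K : ℤ) * A) :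
    ∃ lo hi : ℤ, -y₀ ≤ lo ∧ hi ≤ 2 * (K : ℤ) * A - y₀ ∧
      (∀ e, lo ≤ e → e ≤ hi → 0 ≤ y₀ + e ∧ y₀ + e ≤ 2 * (K : ℤ) * A) ∧
      β ≤ ∑ n ∈ Finset.range (Ns + 1), ∑ _ω ∈ (Zd.saws 2 n).filter (fun ω =>
        (∀ i ≤ n, 0 ≤ ω i 0 ∧ ω i 0 ≤ (w : ℤ) ∧ lo ≤ ω i 1 ∧ ω i 1 ≤ hi) ∧ ω n 0 = (w : ℤ)),
        criticalFugacity ^ n := by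
  have hKw : (K : ℤ) * w ≤ (K : ℤ) * A := by exact_mod_cast Nat.mul_le_mul_left K hwA
  have hK0 : 0 ≤ (K : ℤ) * w := by positivity
  by_cases h : y₀ < (K : ℤ) * w
  · exact ⟨0, (K : ℤ) * w, by linarith, by linarith, fun e h1 h2 => ⟨by linarith, by linarith⟩, hfl⟩
  · have h' := not_lt.1 h
    refine ⟨-((K : ℤ) * w), 0, by linarith, by linarith, fun e h1 h2 => ⟨by linarith, by linarith⟩, ?_⟩
    have := bmass_mirror w 0 ((K : ℤ) * w) Ns
    rw [neg_zero] at this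
    rw [this]
    exact hfl

/-- Total width of a chain with at least two pieces: the pieces occupy consecutive disjoint column ranges,
consecutive pieces being joined by one east edge, so the width is `Σ (wᵢ + 1) - 1`. -/
theorem chainWidth_cons (w : ℕ) {ws : List ℕ} (h : ws ≠ []) :
    ((w :: ws).map (· + 1)).sum - 1 = w + 1 + ((ws.map (· + 1)).sum - 1) := by
  obtain ⟨w', ws', rfl⟩ := List.exists_cons_of_ne_nil h
  simp only [List.map_cons, List.sum_cons]
  omega

/-- Length cut-off of a chain with at least two pieces: `Ns` steps per piece plus the joining edges. -/
theorem chainLen_cons (Ns w : ℕ) {ws : List ℕ} (h : ws ≠ []) :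
    (w :: ws).length * (Ns + 1) - 1 = Ns + 1 + (ws.length * (Ns + 1) - 1) := by
  obtain ⟨w', ws', rfl⟩ := List.exists_cons_of_ne_nil h
  simp only [List.length_cons]
  have h1 : (ws'.length + 1 + 1) * (Ns + 1) = (ws'.length + 1) * (Ns + 1) + (Ns + 1) := by ring
  have h2 : Ns + 1 ≤ (ws'.length + 1) * (Ns + 1) := Nat.le_mul_of_pos_left _ (Nat.succ_pos _)
  omega

/-- **The steered chain (main lemma).** For a nonempty list `ws` of piece widths `w ≤ A`, each with floor `β`
for its up-family at cut-off `Ns`, and every current height `y₀ ∈ [0, 2KA]`, the box of width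
`Σ_{w ∈ ws} (w + 1) - 1` with height window `[-y₀, 2KA - y₀]` (absolute heights `[0, 2KA]`) has partial mass
`≥ (x_c β)^{|ws|}` at cut-off `|ws| (Ns + 1) - 1`: enter the first piece up or down according to `y₀`, join
by one east edge, and continue with the remaining pieces from the new height (induction on `ws`). -/
theorem chain_mass (K A Ns : ℕ) {β : ℝ} (hβ : 0 ≤ β) :
    ∀ ws : List ℕ, ws ≠ [] →
      (∀ w ∈ ws, w ≤ A ∧ β ≤ ∑ n ∈ Finset.range (Ns + 1), ∑ _ω ∈ (Zd.saws 2 n).filter (fun ω =>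
        (∀ i ≤ n, 0 ≤ ω i 0 ∧ ω i 0 ≤ (w : ℤ) ∧ 0 ≤ ω i 1 ∧ ω i 1 ≤ (K : ℤ) * w) ∧ ω n 0 = (w : ℤ)),
        criticalFugacity ^ n) →
      ∀ y₀ : ℤ, 0 ≤ y₀ → y₀ ≤ 2 * (K : ℤ) * A →
        (criticalFugacity * β) ^ ws.length ≤
          ∑ n ∈ Finset.range (ws.length * (Ns + 1) - 1 + 1), ∑ _ω ∈ (Zd.saws 2 n).filter (fun ω =>
            (∀ i ≤ n, 0 ≤ ω i 0 ∧ ω i 0 ≤ (((ws.map (· + 1)).sum - 1 : ℕ) : ℤ) ∧ -y₀ ≤ ω i 1 ∧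
              ω i 1 ≤ 2 * (K : ℤ) * A - y₀) ∧ ω n 0 = (((ws.map (· + 1)).sum - 1 : ℕ) : ℤ)),
            criticalFugacity ^ n := by
  obtain ⟨hx0, hx1⟩ := criticalFugacity_pos_le_one
  intro ws
  induction ws with
  | nil => intro h; exact absurd rfl h
  | cons w ws ih =>
    intro _ hws y₀ hy0 hyH
    obtain ⟨hwA, hflw⟩ := hws w List.mem_cons_self
    obtain ⟨lo, hi, hlo, hhi, hsteer, hfl⟩ := piece_exists K A Ns w β hwA hflw y₀ hy0 hyH
    by_cases hnil : ws = []
    · subst hnil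
      have hW : ([w].map (· + 1)).sum - 1 = w := by simp
      have hN : [w].length * (Ns + 1) - 1 = Ns := by simp
      rw [hW, hN, List.length_singleton, pow_one]
      calc criticalFugacity * β ≤ β := mul_le_of_le_one_left hβ hx1
        _ ≤ _ := hfl
        _ ≤ _ := bmass_mono w le_rfl hlo hhi
    · have ih' := ih hnil fun w' hw' => hws w' (List.mem_cons_of_mem w hw')
      rw [chainWidth_cons w hnil, chainLen_cons Ns w hnil, List.length_cons, pow_succ]
      refine le_trans ?_
        (glue_mass w ((ws.map (· + 1)).sum - 1) Ns (ws.length * (Ns + 1) - 1) hlo hhi)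
      rw [show (criticalFugacity * β) ^ ws.length * (criticalFugacity * β) =
        criticalFugacity * (β * (criticalFugacity * β) ^ ws.length) by ring]
      refine mul_le_mul_of_nonneg_left
        (le_trans (mul_le_mul_of_nonneg_right hfl (by positivity)) ?_) hx0.le
      rw [Finset.sum_mul]
      refine Finset.sum_le_sum fun m _ => ?_
      rw [Finset.sum_mul]
      refine Finset.sum_le_sum fun ω hω => mul_le_mul_of_nonneg_left ?_ (pow_nonneg hx0.le m)
      -- the remaining pieces, from the new height `y₀ + ω m 1 ∈ [0, 2KA]`
      obtain ⟨-, -, h3, h4⟩ := boxAt_bounds hω m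
      obtain ⟨h5, h6⟩ := hsteer (ω m 1) h3 h4
      have := ih' (y₀ + ω m 1) h5 h6
      rwa [neg_add', ← sub_sub] at this

/-! ### Fitting the chain into the flat box of aspect `5` -/

/-- The straight walk of length `X` lies in the family of `OneSidedReach` at `X`. -/
theorem straightWalk_mem_reach (X : ℕ) :
    Zd.straightWalk 2 X ∈ (Zd.saws 2 X).filter (fun ω =>
      (∀ i ≤ X, 0 ≤ ω i 0 ∧ ω i 0 ≤ (X : ℤ) ∧ 0 ≤ ω i 1 ∧ 5 * ω i 1 ≤ (X : ℤ)) ∧ ω X 0 = (X : ℤ)) := by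
  refine Finset.mem_filter.2 ⟨Zd.straightWalk_mem_saws 2 X, fun i hi => ?_, by simp [Zd.straightWalk]⟩
  simp [Zd.straightWalk, hi]

/-- A single member of a family graded by length bounds its partial mass from below by its weight. -/
theorem pow_le_pmass {F : ℕ → Finset (ℕ → Site 2)} {N n : ℕ} {ω : ℕ → Site 2} (hn : n ≤ N)
    (h : ω ∈ F n) : criticalFugacity ^ n ≤ ∑ k ∈ Finset.range (N + 1), ∑ _ω ∈ F k, criticalFugacity ^ k :=
  calc criticalFugacity ^ n ≤ ∑ _ω ∈ F n, criticalFugacity ^ n :=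
      Finset.single_le_sum (f := fun _ => criticalFugacity ^ n)
        (fun _ _ => pow_nonneg criticalFugacity_pos.le n) h
    _ ≤ ∑ k ∈ Finset.range (N + 1), ∑ _ω ∈ F k, criticalFugacity ^ k :=
      Finset.single_le_sum (f := fun k => ∑ _ω ∈ F k, criticalFugacity ^ k)
        (fun k _ => Finset.sum_nonneg fun _ _ => pow_nonneg criticalFugacity_pos.le k)
        (Finset.mem_range.2 (by omega))

end SteeredChain

open SteeredChain

/-- **`stub_steeredChain`** (S2 of the line `lieb-simon-star`): ONE-SIDED SIGN STEERING.  From the corner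
crossing floor for the tall boxes `[0, a] × [0, K a]` (with constants `K, C, c`), chain `k = 10 K + 2` pieces of
widths `a` or `a + 1` eastwards in disjoint column ranges joined by single east edges, entering each piece at its
south-west corner (go up) when the current height is `< K·width` and at its north-west corner (mirror family, go
down) otherwise: heights stay in `[0, 2K(a+1)] ⊆ [0, X/5]` and the chain ends on the column
`x = X = Σ (wᵢ + 1) − 1` (every `X ≥ 2k − 1` is so realised; smaller `X` by the straight walk).  Masses multiply
(`chain_mass`), giving the floor `(x_c min(c,1))^{2k} X^{−kC}` for `OneSidedReach`. -/
theorem stub_steeredChain : CornerCrossingFloor → OneSidedReach := by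
  rintro ⟨K, C, c, hC, hc, hfloor⟩
  obtain ⟨hx0, hx1⟩ := criticalFugacity_pos_le_one
  obtain ⟨k, hk⟩ : ∃ k : ℕ, k = 10 * K + 2 := ⟨_, rfl⟩
  have hk2 : 2 ≤ k := by omega
  obtain ⟨c₁, hc₁⟩ : ∃ c₁ : ℝ, c₁ = min c 1 := ⟨_, rfl⟩
  have hc₁0 : 0 < c₁ := hc₁ ▸ lt_min hc one_pos
  have hc₁1 : c₁ ≤ 1 := hc₁ ▸ min_le_right _ _
  have hc₁c : c₁ ≤ c := hc₁ ▸ min_le_left _ _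
  have hxc0 : 0 ≤ criticalFugacity * c₁ := by positivity
  have hxc1 : criticalFugacity * c₁ ≤ 1 := mul_le_one₀ hx1 hc₁0.le hc₁1
  refine ⟨(k : ℝ) * C, (criticalFugacity * c₁) ^ (2 * k), by positivity, pow_pos (mul_pos hx0 hc₁0) _,
    fun X hX => ?_⟩
  have hXC : (X : ℝ) ^ (-((k : ℝ) * C)) ≤ 1 :=
    Real.rpow_le_one_of_one_le_of_nonpos (by exact_mod_cast hX) (neg_nonpos.2 (by positivity))
  have hc'1 : (criticalFugacity * c₁) ^ (2 * k) * (X : ℝ) ^ (-((k : ℝ) * C)) ≤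
      (criticalFugacity * c₁) ^ (2 * k) := mul_le_of_le_one_right (pow_nonneg hxc0 _) hXC
  by_cases hsmall : X + 1 < 2 * k
  · -- short boxes: the straight walk
    refine ⟨X, hc'1.trans (le_trans ?_ (pow_le_pmass le_rfl (straightWalk_mem_reach X)))⟩
    calc (criticalFugacity * c₁) ^ (2 * k) ≤ criticalFugacity ^ (2 * k) := by
          rw [mul_pow]
          exact mul_le_of_le_one_right (pow_nonneg hx0.le _) (pow_le_one₀ hc₁0.le hc₁1)
      _ ≤ criticalFugacity ^ X := pow_le_pow_of_le_one hx0.le hx1 (by omega)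
  · -- long boxes: the steered chain
    have h2k : 2 * k ≤ X + 1 := not_lt.1 hsmall
    have hkpos : 0 < k := by omega
    obtain ⟨q, hq⟩ : ∃ q : ℕ, q = (X + 1) / k := ⟨_, rfl⟩
    obtain ⟨r, hr⟩ : ∃ r : ℕ, r = (X + 1) % k := ⟨_, rfl⟩
    have hqr : k * q + r = X + 1 := by rw [hq, hr]; exact Nat.div_add_mod (X + 1) k
    have hq2 : 2 ≤ q := by rw [hq]; exact (Nat.le_div_iff_mul_le hkpos).2 (by linarith)
    have hrk : r < k := by rw [hr]; exact Nat.mod_lt _ hkpos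
    obtain ⟨a, ha⟩ : ∃ a : ℕ, a = q - 1 := ⟨_, rfl⟩
    have ha1 : 1 ≤ a := by omega
    have haq : a + 1 = q := by omega
    obtain ⟨Na, hNa⟩ := hfloor a ha1
    obtain ⟨Nq, hNq⟩ := hfloor q (by omega)
    have hNa' := hNa.trans (bmass_mono a (le_max_left Na Nq) (le_refl (0 : ℤ)) (le_refl ((K : ℤ) * a)))
    have hNq' := hNq.trans (bmass_mono q (le_max_right Na Nq) (le_refl (0 : ℤ)) (le_refl ((K : ℤ) * q)))
    obtain ⟨β, hβ⟩ : ∃ β : ℝ, β = c * (q : ℝ) ^ (-C) := ⟨_, rfl⟩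
    have hβ0 : 0 ≤ β := by rw [hβ]; positivity
    have hq0 : (0 : ℝ) < q := by exact_mod_cast (by omega : 0 < q)
    have hne : List.replicate r q ++ List.replicate (k - r) a ≠ [] := by
      simp only [ne_eq, List.append_eq_nil_iff, List.replicate_eq_nil_iff]
      omega
    have key := chain_mass K q (max Na Nq) hβ0 _ hne (fun w hw => by
      rcases List.mem_append.1 hw with h | h
      · rw [(List.mem_replicate.1 h).2, hβ]
        exact ⟨le_rfl, hNq'⟩
      · rw [(List.mem_replicate.1 h).2, hβ]
        refine ⟨by omega, le_trans ?_ hNa'⟩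
        exact mul_le_mul_of_nonneg_left (Real.rpow_le_rpow_of_nonpos (by exact_mod_cast ha1)
          (by exact_mod_cast (by omega : a ≤ q)) (by linarith)) hc.le) 0 le_rfl (by positivity)
    have hlen : (List.replicate r q ++ List.replicate (k - r) a).length = k := by
      simp only [List.length_append, List.length_replicate]
      omega
    have hW : ((List.replicate r q ++ List.replicate (k - r) a).map (· + 1)).sum - 1 = X := by
      simp only [List.map_append, List.map_replicate, List.sum_append, List.sum_replicate,
        smul_eq_mul, haq]
      have hrk' : r + (k - r) = k := by omega
      have : r * (q + 1) + (k - r) * q = k * q + r := by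
        calc r * (q + 1) + (k - r) * q = (r + (k - r)) * q + r := by ring
          _ = k * q + r := by rw [hrk']
      omega
    rw [hlen, hW, neg_zero, sub_zero] at key
    refine ⟨k * (max Na Nq + 1) - 1, le_trans ?_ (key.trans ?_)⟩
    · -- the constants
      have hqX : (q : ℝ) ≤ X := by
        have : 2 * q ≤ k * q := Nat.mul_le_mul_right q hk2
        exact_mod_cast (by omega : q ≤ X)
      have h1 : (criticalFugacity * c₁) ^ (2 * k) ≤ (criticalFugacity * c) ^ k :=
        calc (criticalFugacity * c₁) ^ (2 * k) ≤ (criticalFugacity * c₁) ^ k :=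
              pow_le_pow_of_le_one hxc0 hxc1 (by omega)
          _ ≤ (criticalFugacity * c) ^ k :=
              pow_le_pow_left₀ hxc0 (mul_le_mul_of_nonneg_left hc₁c hx0.le) k
      have h2 : (X : ℝ) ^ (-((k : ℝ) * C)) ≤ ((q : ℝ) ^ (-C)) ^ k := by
        rw [show -((k : ℝ) * C) = -C * k by ring, Real.rpow_mul (by positivity), Real.rpow_natCast]
        exact pow_le_pow_left₀ (by positivity) (Real.rpow_le_rpow_of_nonpos hq0 hqX (by linarith)) k
      calc (criticalFugacity * c₁) ^ (2 * k) * (X : ℝ) ^ (-((k : ℝ) * C))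
          ≤ (criticalFugacity * c) ^ k * ((q : ℝ) ^ (-C)) ^ k :=
            mul_le_mul h1 h2 (by positivity) (by positivity)
        _ = (criticalFugacity * β) ^ k := by rw [hβ]; ring
    · -- the chain box `[0, X] × [0, 2Kq]` lies in the flat box: `10 K q ≤ X`
      have h10 : 10 * (K * q) ≤ X := by
        have : k * q = 10 * (K * q) + 2 * q := by rw [hk]; ring
        omega
      have h10' : 10 * ((K : ℤ) * q) ≤ (X : ℤ) := by exact_mod_cast h10
      refine Finset.sum_le_sum fun n _ => Finset.sum_le_sum_of_subset_of_nonneg (fun ω hω => ?_)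
        fun _ _ _ => pow_nonneg hx0.le n
      obtain ⟨hωs, hb, he⟩ := mem_boxAt.1 hω
      refine Finset.mem_filter.2 ⟨hωs, fun i hi => ?_, he⟩
      obtain ⟨hb1, hb2, hb3, hb4⟩ := hb i hi
      exact ⟨hb1, hb2, hb3, by linarith⟩

end Summit.CriticalPhenomena.SAWScalingLimit.Theorems.TubeLowerBound.LiebSimonStar

end
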